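import Mathlib
import Summits.NavierStokesRegularity.OSWSelfSimilar.SheetNSLineTorusCascadeKernelTwentyOne
import Summits.NavierStokesRegularity.OSWSelfSimilar.SheetNSLineTorusCascadeDataMonotone
import Summits.NavierStokesRegularity.OSWSelfSimilar.SheetNSLineTorusCascadeLinkGeneral
import HarnessLib

/-!
# Viscous CLM on the torus (`a = 0`, `σ = 2`): the datum-free `21ν` threshold of the aggregate window chain CARRIES TO EVERY ODD DATUM
# WITH NONNEGATIVE ANALYTIC-SIGNAL COEFFICIENTS (first mode `a₁ ≥ 21ν`) — cascade level and PDE level, horizon `log(841/500)/ν ≈ 0.52/ν`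

HONEST FRAMING (cell ns-blowup GROUP B «PROFILE SEARCH», zone Z3, row Z3-U addendum A-F2 of `HOME/profile/z3/CENSUS-Z3.md`;
human rulings D-0035/D-0074; Z3-TWIN lineage): **1-D MODEL (viscous Constantin–Lax–Majda equation `ω_t = ω Hω + ν ω_xx` on `𝕋`,
`H = hilbertTransformCircle`); composition of kernel theorems, no new estimate; not Euler, not Navier–Stokes; «violates: none — MODEL».
NO script datum.**

WHAT: exactly the composition of `SheetNSLineTorusCascadeKernelGeneral` (24ν, eng-5 g11 ∘ eng-3 g9) with the sharper datum-free sine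
certificate `unbounded_of_le_twentyOne` (`SheetNSLineTorusCascadeKernelTwentyOne`, aggregate window chain, six exact heads): eng-3's
data-monotonicity slot `IsNonnegCascade.unbounded_of_sine_unbounded` (`SheetNSLineTorusCascadeDataMonotone`) and general-datum PDE link
`horizon_lt_of_sine_unbounded_gen` (`SheetNSLineTorusCascadeLinkGeneral`) take as input what the certificate proves for the sine cascade with
`c = a₁`. Hence:
* `IsNonnegCascade.unbounded_of_le_twentyOne` — every nonnegative-coefficient cascade with `0 < ν`, `21ν ≤ e 1 0` is unbounded in `k` at
  `t = log(841/500)/ν` (was `24ν` at `log 2/ν`); `IsNonnegCascade.first_mode_lt_twentyOne_of_bounded` (census form);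
* `horizon_lt_of_le_twentyOne_gen` — **no classical `2π`-periodic solution of the MODEL PDE from ANY odd datum `−Σ a_k sin kx` with
  `a_k ≥ 0` and `a₁ ≥ 21ν` exists on `[0, log(841/500)/ν]`, `log(841/500) = 0.51998…`** (was `24ν` on `[0, log 2/ν]`,
  `horizon_lt_log_two_of_le_twentyFour_gen`); census form `first_coef_lt_twentyOne_of_classicalSolution`.
bears_on: LADDER-NS N5 / zone Z3 (row Z3-U) → N1 linear core. WHAT THIS IS NOT: not NS; no definitions; nothing numerical outside the kernel.
-/

namespace Summit.NavierStokesRegularity.OSWSelfSimilar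
namespace SheetNSLineTorusCascade

open Finset Real Set

variable {ν : ℝ} {e : ℕ → ℝ → ℝ}

/-- **`21ν` FOR EVERY NONNEGATIVE-COEFFICIENT DATUM (cascade level, datum-free).** A nonnegative cascade with `0 < ν` and first mode
`e 1 0 ≥ 21ν` has `k ↦ e_k(log(841/500)/ν)` unbounded above. [new here — MODEL] -/
theorem IsNonnegCascade.unbounded_of_le_twentyOne (he : IsNonnegCascade ν e) (hν : 0 < ν) (hc : 21 * ν ≤ e 1 0) :
    ∀ M : ℝ, ∃ k : ℕ, M < e k (Real.log (841 / 500) / ν) :=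
  he.unbounded_of_sine_unbounded (div_pos (Real.log_pos (by norm_num)) hν).le
    (SheetNSLineTorusCascade.unbounded_of_le_twentyOne hν hc (isSineCascade_cascadeSolution ν (e 1 0)))

/-- Census form: a nonnegative cascade bounded at `t = log(841/500)/ν` (`ν > 0`) has first mode `< 21ν`. [new here — MODEL] -/
theorem IsNonnegCascade.first_mode_lt_twentyOne_of_bounded (he : IsNonnegCascade ν e) (hν : 0 < ν)
    (hbdd : ∃ M : ℝ, ∀ k : ℕ, e k (Real.log (841 / 500) / ν) ≤ M) : e 1 0 < 21 * ν := by
  by_contra h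
  obtain ⟨M, hM⟩ := hbdd
  obtain ⟨k, hk⟩ := he.unbounded_of_le_twentyOne hν (not_lt.mp h) M
  exact absurd (hM k) (not_le.mpr hk)

/-- **`21ν` FOR EVERY ODD DATUM WITH NONNEGATIVE ANALYTIC-SIGNAL COEFFICIENTS (PDE level, datum-free).** If `ω` is a classical
`2π`-periodic solution of `ω_t = ω·Hω + ν ω_xx` on `[0, T]` whose datum has cascade variables `coef ω k 0 = a_k ∈ ℝ`, `a_k ≥ 0`, mean zero,
and `a₁ ≥ 21ν` (`ν > 0`), then `T < log(841/500)/ν` (`≈ 0.5200/ν`). [new here — MODEL] -/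
theorem horizon_lt_of_le_twentyOne_gen {T : ℝ} {ω ωt ωx ωxx : ℝ → ℝ → ℝ} (h : IsClassicalSolution ν T ω ωt ωx ωxx)
    {a : ℕ → ℝ} (hdat : ∀ k : ℕ, coef ω k 0 = ((a k : ℝ) : ℂ)) (ha : ∀ k, 0 ≤ a k) (hmean : mode ω 0 0 = 0)
    (hν : 0 < ν) (hc : 21 * ν ≤ a 1) : T < Real.log (841 / 500) / ν :=
  horizon_lt_of_sine_unbounded_gen h hdat ha hmean (div_pos (Real.log_pos (by norm_num)) hν)
    (SheetNSLineTorusCascade.unbounded_of_le_twentyOne hν hc (isSineCascade_cascadeSolution ν (a 1)))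

/-- Census form at the PDE level: a classical solution from such a datum that exists on `[0, T]` with `log(841/500)/ν ≤ T` has `a₁ < 21ν`.
[new here — MODEL] -/
theorem first_coef_lt_twentyOne_of_classicalSolution {T : ℝ} {ω ωt ωx ωxx : ℝ → ℝ → ℝ}
    (h : IsClassicalSolution ν T ω ωt ωx ωxx) {a : ℕ → ℝ} (hdat : ∀ k : ℕ, coef ω k 0 = ((a k : ℝ) : ℂ)) (ha : ∀ k, 0 ≤ a k)
    (hmean : mode ω 0 0 = 0) (hν : 0 < ν) (hT : Real.log (841 / 500) / ν ≤ T) : a 1 < 21 * ν := by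
  by_contra hcon
  exact absurd hT (not_le.mpr (horizon_lt_of_le_twentyOne_gen h hdat ha hmean hν (not_lt.mp hcon)))

end SheetNSLineTorusCascade
end Summit.NavierStokesRegularity.OSWSelfSimilar
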